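import Mathlib

/-!
# Joining two points of an open connected planar set by an open connected set with compact closure inside

Two points `x, β` of an open connected `D ⊆ ℂ` lie in an open connected `D'` with `D' ⊆ K ⊆ D`
for some compact `K`: join them by a path in `D` (open connected subsets of `ℂ` are path connected),
thicken the compact range of the path inside `D`, and take the open `δ/2`-thickening as `D'` and the
closed `δ/2`-thickening as `K`.  Pure plane topology; Mathlib only.
-/

namespace Summit.QuantumFields.YangMills.Theorems.FreeEnergyWindowChannel

open Set Metric

/-- **Connected compact join.**  If `D ⊆ ℂ` is open and connected and `x, β ∈ D`, then there are an
open connected `D'` and a compact `K` with `x, β ∈ D' ⊆ K ⊆ D`.  Proof: `D` is path connected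
(`IsOpen.isConnected_iff_isPathConnected`); a path `γ` from `x` to `β` in `D` has compact range, so some
closed thickening `cthickening δ (range γ)` (`δ > 0`) stays inside the open set `D`; then
`D' := thickening (δ/2) (range γ)` is open, contains `range γ ∋ x, β`, and is connected as the union
over `y ∈ range γ` of the connected sets `range γ ∪ ball y (δ/2)` through `x`, while
`K := cthickening (δ/2) (range γ)` is compact (`ℂ` is proper) and `D' ⊆ K ⊆ cthickening δ ⊆ D`.
[folklore] -/
theorem stub_connectedCompactJoin :
    ∀ (D : Set ℂ), IsOpen D → IsConnected D → ∀ x ∈ D, ∀ β ∈ D,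
      ∃ D' K : Set ℂ, IsOpen D' ∧ IsConnected D' ∧ IsCompact K ∧ x ∈ D' ∧ β ∈ D' ∧ D' ⊆ K ∧ K ⊆ D := by
  intro D hD hDc x hx β hβ
  -- a path from `x` to `β` inside `D`
  have hpath : IsPathConnected D := hD.isConnected_iff_isPathConnected.1 hDc
  have hJ : JoinedIn D x β := hpath.joinedIn x hx β hβ
  set γ : Path x β := hJ.somePath with hγ
  have hγD : ∀ t, γ t ∈ D := hJ.somePath_mem
  -- a closed thickening of its compact range inside `D`
  obtain ⟨δ, hδ0, hδD⟩ := (isCompact_range γ.continuous).exists_cthickening_subset_open hD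
    (range_subset_iff.2 hγD)
  have hδ2 : 0 < δ / 2 := half_pos hδ0
  have hsub : range γ ⊆ thickening (δ / 2) (range γ) := self_subset_thickening hδ2 _
  have hxγ : x ∈ range γ := ⟨0, γ.source⟩
  have hβγ : β ∈ range γ := ⟨1, γ.target⟩
  refine ⟨thickening (δ / 2) (range γ), cthickening (δ / 2) (range γ), isOpen_thickening, ?_,
    (isCompact_range γ.continuous).cthickening, hsub hxγ, hsub hβγ,
    thickening_subset_cthickening _ _, (cthickening_mono (by linarith) _).trans hδD⟩
  -- connectedness of the open thickening: every point lies in a ball centred on the connected `range γ`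
  refine ⟨⟨x, hsub hxγ⟩, isPreconnected_of_forall x fun z hz => ?_⟩
  obtain ⟨y, hy, hzy⟩ := mem_thickening_iff.1 hz
  refine ⟨range γ ∪ ball y (δ / 2), union_subset hsub (ball_subset_thickening hy _), Or.inl hxγ,
    Or.inr (mem_ball.2 hzy), ?_⟩
  exact IsPreconnected.union y hy (mem_ball_self hδ2) (isPreconnected_range γ.continuous)
    (convex_ball y _).isPreconnected

end Summit.QuantumFields.YangMills.Theorems.FreeEnergyWindowChannel
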